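import Summits.BirchSwinnertonDyer.BirchSwinnertonDyer.Theorems.UniversalToricDescentThinCombVerticalCharacter
import Summits.BirchSwinnertonDyer.BirchSwinnertonDyer.Theorems.UniversalToricDescentThinCombReflectedAvatar
import Literature.NumberTheory.GaloisRepresentations.EverywhereUnramifiedAlgebraicHeckeCharacter
import Literature.NumberTheory.EllipticCurves.RankinSelbergHeckeContinuation
import HarnessLib

/-!
# The rational wall `RationalSplitIMCInclusionAtThree` (stmt-BirchSwinnertonDyer-24207), line `ratwall_thin_comb`: input (S) of stub 1 is a
# THEOREM — the FIBRED SUPPLY of interpolation characters through the pair in a `𝔭`-adapted frame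
# (`--supports stmt-BirchSwinnertonDyer-24207`; cell `pub/bsd-wall`, LEAD `cruxlead-24207` g33; nothing is closed; BSD is not proved)

WHY. The certificates `…RationalSplitIMCInclusionAtThreeClosedModuloV83{,Jacquet,Print}.lean` derive the registered first stub of the line
(`stub_toricExistsSymmUpTo2`, v8.2 VERBATIM) from (N) a normalised ♯♯-frame, Jacquet's functional equation on the cone (the print fact
`jacquet1972_functionalEquation_rankinSelbergHecke_cone`, BY NAME) and ONE MORE displayed hypothesis `hS` — the FIBRED SUPPLY
(SUPPLY-GRID-utd-idea-g59 §2: S-a Weil existence, S-b through the pair, S-c continuation, S-d the fibration; «print + kernel, to do»).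
This file PROVES `hS` (in the frame of the stub, i.e. with the Heegner hypothesis and the frame involution `τ` at hand), modulo the same
named print fact for the continuation clause S-c. Inputs, all tree theorems: S-a = `HeckeCharacter.exists_hasInfinityType_pos_zero_unramified`
(type `(h_K·w_K, 0)`, any class number; p768280), S-b/S-d = `…ThinComb.VerticalCharacter.exists_verticalCharacter` (Weil's avatar through the
pair, `χ(γ₂) = 1`, non-torsion off the `γ₂`-line), the reflected partner `ψ† = (ψ∘c̄)⁻¹` with avatar `r†(g) = r(τ g)` (`…ThinComb.ReflectedAvatar`,
p766983), and the frame geometry `κ₁(τ γ₂) ≠ 0` (`…ThinComb.FrameInvolution`, p744231).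

THE SUPPLY (`fibredSupply`). Data: `K` imaginary quadratic, `p` odd, split, `𝔭 ≠ 𝔭′` above `p`, `ι′ : ℚ̄_p ≃ ℂ` inducing `𝔭`
(`BranchInducesPrime`), a newform `Dt.f` of level `N` with the Heegner hypothesis for `(N, K)`, a generator pair `(κ₁, κ₂; γ₁, γ₂)` with `κ₁`
unramified outside `𝔭`, and a lift `τ` of `g ↦ c g⁻¹ c⁻¹` (`c ∉ res Γ_K`). With `Ψ` of type `(k, 0)` and its vertical character `χ`
(`e∘χⁿ` = avatar of `Ψ^{Mn}`), the characters `ψ_{ij} := Ψ^{M(i+1)} · (Ψ^{M(j+1)} ∘ c̄)⁻¹` (`i, j ≥ 0`) have type `(kM(i+1), −kM(j+1))`, are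
unramified everywhere, have avatars `e∘(χ^{i+1}·(χ^{j+1})†)` through the pair, admit Jacquet's continuation, and sit at the points
`x_{ij} = χ(γ₁)^{i+1}·χ(τγ₁)^{j+1} − 1`, `y_j = χ(τγ₂)^{j+1} − 1` (since `χ(γ₂) = 1`): `y_j` does not depend on `i`, the `y_j` are pairwise
distinct (`χ(τγ₂)` is not a root of unity: `κ₁(τγ₂) ≠ 0`) and for fixed `j` the `x_{ij}` are pairwise distinct (`χ(γ₁)` is not a root of unity:
`κ₁ γ₁ = 1`); all of them are one-units of level `|p|`, so `ϖ = p` bounds the bidisc.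

CONSEQUENCE (next file, the certificate `…ClosedModuloV84`): stub 1 of the line ⟸ (N) + the Jacquet fact BY NAME, and the crux BY NAME ⟸
(N) + Jacquet + Nekovář + stub 3 — the v8.3 residue loses its «(S): print + kernel-todo» entry.

HONEST SCOPE: bookkeeping of class field theory for the interpolation set of a two-variable `p`-adic `L`-function; the continuation clause is
Jacquet 1972 Cor. 19.15 taken as the tree's named fact; nothing here is evidence that a toric frame exists at the additive split `3`;
24207 / 20395 / 20186 OPEN; BSD is proved for no curve.

References: [Weil1956] §1–§2; [SerreAbelianLadic1968] Ch. III §2.3; [Jacquet1972] §19 Cor. 19.15; [BuyukbodukLei2017] Def. 3.8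
(arXiv:1707.00557); [deShalit1987] II.1.4 Lemma (ii), II.4.17; [Washington1997] §13.1, Thm. 13.4; [Brink2007] Cor. 1.
-/

set_option linter.dupNamespace false
set_option autoImplicit false

noncomputable section

open scoped NumberField
open NumberField IsDedekindDomain Field
open Literature Literature.NumberTheory.GaloisRepresentations Literature.NumberTheory.EllipticCurves
open Literature.NumberTheory.EllipticCurves.ModularForms
open Summit.BirchSwinnertonDyer.Rank1Residual.X11b.Three.LambdaSupply
open Summit.BirchSwinnertonDyer.BirchSwinnertonDyer.Theorems.PrintCf2
open Summit.BirchSwinnertonDyer.BirchSwinnertonDyer.Theorems.CycTangentCMCycTangentBoundSplitPrimePowerLine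

namespace Summit.BirchSwinnertonDyer.BirchSwinnertonDyer.Theorems.UniversalToricDescentThinComb.FibredSupply

variable {p : ℕ} [Fact p.Prime] {K : Type} [Field K] [NumberField K]

/-! ### §1. Small bookkeeping: products through the pair, one-units -/

omit [NumberField K] in
/-- Products of characters through the pair are through the pair (`e` is a homomorphism). [cite: Washington1997, Thm. 13.4] -/
theorem factorsThroughPair_unitsChar_mul {κ₁ κ₂ : ZpExtension K p} {ψ ψ' : absoluteGaloisGroup K →ₜ* (PadicAlgCl p)ˣ}
    (h : FactorsThroughPair κ₁ κ₂ ((FramedRep.unitsContinuousMulEquivOfUnique (Fin 1) (PadicAlgCl p) :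
      (PadicAlgCl p)ˣ →ₜ* GL (Fin 1) (PadicAlgCl p)).comp ψ))
    (h' : FactorsThroughPair κ₁ κ₂ ((FramedRep.unitsContinuousMulEquivOfUnique (Fin 1) (PadicAlgCl p) :
      (PadicAlgCl p)ˣ →ₜ* GL (Fin 1) (PadicAlgCl p)).comp ψ')) :
    FactorsThroughPair κ₁ κ₂ ((FramedRep.unitsContinuousMulEquivOfUnique (Fin 1) (PadicAlgCl p) :
      (PadicAlgCl p)ˣ →ₜ* GL (Fin 1) (PadicAlgCl p)).comp (ψ * ψ')) := by
  intro σ h₁ h₂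
  have e1 := h σ h₁ h₂
  have e2 := h' σ h₁ h₂
  rw [ContinuousMonoidHom.comp_toFun] at e1 e2 ⊢
  change (FramedRep.unitsContinuousMulEquivOfUnique (Fin 1) (PadicAlgCl p)) ((ψ * ψ') σ) = 1
  change (FramedRep.unitsContinuousMulEquivOfUnique (Fin 1) (PadicAlgCl p)) (ψ σ) = 1 at e1
  change (FramedRep.unitsContinuousMulEquivOfUnique (Fin 1) (PadicAlgCl p)) (ψ' σ) = 1 at e2
  rw [ContinuousMonoidHom.mul_apply, map_mul, e1, e2, mul_one]

/-- One-units multiply: `‖u·v − 1‖ < ρ` if `‖u‖ ≤ 1`, `‖u − 1‖ < ρ`, `‖v − 1‖ < ρ` (ultrametric). [folklore] -/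
theorem norm_mul_sub_one_lt {u v : ℂ_[p]} {ρ : ℝ} (hu1 : ‖u‖ ≤ 1) (hu : ‖u - 1‖ < ρ) (hv : ‖v - 1‖ < ρ) :
    ‖u * v - 1‖ < ρ := by
  have h : u * v - 1 = u * (v - 1) + (u - 1) := by ring
  rw [h]
  refine lt_of_le_of_lt (IsUltrametricDist.norm_add_le_max _ _) (max_lt ?_ hu)
  calc ‖u * (v - 1)‖ = ‖u‖ * ‖v - 1‖ := norm_mul _ _
    _ ≤ 1 * ‖v - 1‖ := by gcongr
    _ = ‖v - 1‖ := one_mul _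
    _ < ρ := hv

/-- A unit of `ℂ_p` which is not a root of unity has pairwise distinct powers: `n ↦ c · u^{n+1} − 1` is injective for `c ≠ 0`. [folklore] -/
theorem injective_mul_pow_sub_one {u c : ℂ_[p]} (hc : c ≠ 0) (hu0 : u ≠ 0) (hu : ∀ n : ℕ, 0 < n → u ^ n ≠ 1) :
    Function.Injective fun n : ℕ ↦ c * u ^ (n + 1) - 1 := by
  have key : ∀ i j : ℕ, i < j → c * u ^ (i + 1) - 1 ≠ c * u ^ (j + 1) - 1 := by
    intro i j hij h
    have h1 : u ^ (i + 1) = u ^ (j + 1) := mul_left_cancel₀ hc (sub_left_inj.mp h)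
    have h2 : u ^ (j + 1) = u ^ (i + 1) * u ^ (j - i) := by
      rw [← pow_add]; congr 1; omega
    have h3 : u ^ (j - i) = 1 := (mul_eq_left₀ (pow_ne_zero _ hu0)).mp (h2.symm.trans h1.symm)
    exact hu (j - i) (by omega) h3
  intro i j h
  by_contra hne
  rcases Nat.lt_or_gt_of_ne hne with hlt | hlt
  · exact key i j hlt h
  · exact key j i hlt h.symm

/-! ### §2. The fibred supply -/

/-- **THE FIBRED SUPPLY OF INTERPOLATION CHARACTERS THROUGH THE PAIR** (input (S) of the v8.3 certificates of the rational wall, as a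
theorem modulo Jacquet's cone fact): in a `𝔭`-adapted frame of the `ℤ_p²`-tower of an imaginary quadratic `K` (`p` odd and split, `ι′`
inducing `𝔭`, `κ₁` unramified outside `𝔭`), for a newform `f` of level `N` with the Heegner hypothesis and any lift `τ` of `g ↦ c g⁻¹ c⁻¹`,
there are `ϖ ≠ 0` with `‖ϖ‖ < 1` and an infinite set `D₂` of inner values such that over every `y ∈ D₂` infinitely many `x` carry an
interpolation datum `(ψ, a, b, r, L)`: `ψ` everywhere unramified of type `(a, −b)`, `a, b ≥ 1`, `r` its `p`-adic avatar through the pair,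
`L` an entire continuation of `L(f/K, ψ, s)`, and `(x, y) = (r(γ₁) − 1, r(γ₂) − 1)`.
[cite: Weil1956, §1–§2] [cite: Jacquet1972, §19 Cor. 19.15] [cite: BuyukbodukLei2017, Def. 3.8 (arXiv:1707.00557)]
[cite: deShalit1987, II.1.4 Lemma (ii)] [cite: Washington1997, §13.1, Thm. 13.4] -/
theorem fibredSupply (hJ : jacquet1972_functionalEquation_rankinSelbergHecke_cone) (hp2 : p ≠ 2)
    (hK : IsImaginaryQuadratic K) {N : ℕ} [NeZero N] (W : WeierstrassCurve ℚ)
    (Dt : Literature.NumberTheory.EllipticCurves.ModularForms.ModularParametrizationData W N)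
    (hH : SatisfiesHeegnerHypothesis N K)
    {𝔭 : HeightOneSpectrum (𝓞 K)} (h3 : ((p : ℕ) : 𝓞 K) ∈ 𝔭.asIdeal)
    {𝔭' : HeightOneSpectrum (𝓞 K)} (h3' : ((p : ℕ) : 𝓞 K) ∈ 𝔭'.asIdeal) (hne : 𝔭' ≠ 𝔭)
    (ι' : PadicAlgCl p ≃+* ℂ) (hι : ∀ (w : InfinitePlace K) (k : 𝓞 K), k ∈ 𝔭.asIdeal ↔ ‖ι'.symm (w.embedding (k : K))‖ < 1)
    {κ₁ κ₂ : ZpExtension K p} {γ₁ γ₂ : absoluteGaloisGroup K} (hpair : ZpExtension.IsTopGeneratorPair κ₁ κ₂ γ₁ γ₂)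
    (hur₁ : ∀ v : HeightOneSpectrum (𝓞 K), v ≠ 𝔭 → ∀ 𝔓 ∈ v.primesAbove,
      𝔓.inertia (absoluteGaloisGroup K) ≤ κ₁.kerSubgroup)
    {c : absoluteGaloisGroup ℚ} (hc : c ∉ Set.range (absGaloisRestrict ℚ K))
    {τ : absoluteGaloisGroup K → absoluteGaloisGroup K}
    (hτ : ∀ σ, absGaloisRestrict ℚ K (τ σ) = c * (absGaloisRestrict ℚ K σ)⁻¹ * c⁻¹) :
    ∃ ϖ : ℂ_[p], ϖ ≠ 0 ∧ ‖ϖ‖ < 1 ∧ ∃ D₂ : Set ℂ_[p], D₂.Infinite ∧ (∀ y ∈ D₂, ‖y‖ ≤ ‖ϖ‖) ∧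
      ∀ y ∈ D₂, {x : ℂ_[p] | ‖x‖ ≤ ‖ϖ‖ ∧
        ∃ (ψ : HeckeCharacter K) (a b : ℕ) (r : FramedGaloisRep K (PadicAlgCl p) 1) (L : ℂ → ℂ),
          1 ≤ a ∧ 1 ≤ b ∧ ψ.HasInfinityType (fun _ ↦ (a : ℤ)) (fun _ ↦ -(b : ℤ)) ∧
          (∀ w : HeightOneSpectrum (𝓞 K), ψ.IsUnramifiedAt w) ∧ IsPAdicAvatarOf ι' ψ r ∧
          FactorsThroughPair κ₁ κ₂ r ∧ Differentiable ℂ L ∧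
          (∀ s : ℂ, (a : ℝ) + 2 < s.re → L s = rankinSelbergEulerProductHecke Dt.f ψ s) ∧
          avatarValueAt r γ₁ - 1 = x ∧ avatarValueAt r γ₂ - 1 = y}.Infinite := by
  classical
  have hp : p.Prime := Fact.out
  haveI : IsTotallyComplex K := hK.2
  haveI : IsGalois ℚ K := Literature.FieldTheory.Galois.isGalois_of_finrank_eq_two hK.1
  set e := (FramedRep.unitsContinuousMulEquivOfUnique (Fin 1) (PadicAlgCl p) :
    (PadicAlgCl p)ˣ →ₜ* GL (Fin 1) (PadicAlgCl p)) with he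
  -- S-a: an everywhere-unramified character of type `(k, 0)`, `k > 0`; S-b/S-d: its vertical character
  obtain ⟨k, Ψ, hk, hΨt, hΨu⟩ := HeckeCharacter.exists_hasInfinityType_pos_zero_unramified (K := K) hK.1
  obtain ⟨M, χ, hM, hall, hsmall, hχγ₂, hntors⟩ :=
    VerticalCharacter.exists_verticalCharacter ι' hK hp2 h3' hne hι hpair hur₁ hk hΨt hΨu
  -- values of `e ∘ χⁿ`
  have hval : ∀ (n : ℕ) (g : absoluteGaloisGroup K),
      avatarValueAt (e.comp (χ ^ n)) g = (((χ g : (PadicAlgCl p)ˣ) : PadicAlgCl p) : ℂ_[p]) ^ n := by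
    intro n g
    simp only [he, avatarValueAt_unitsChar, ContinuousMonoidHom.pow_apply, Units.val_pow_eq_pow_val, PadicComplex.coe_eq, map_pow]
  set u : ℂ_[p] := (((χ γ₁ : (PadicAlgCl p)ˣ) : PadicAlgCl p) : ℂ_[p]) with hu_def
  set v₁ : ℂ_[p] := (((χ (τ γ₁) : (PadicAlgCl p)ˣ) : PadicAlgCl p) : ℂ_[p]) with hv₁_def
  set v₂ : ℂ_[p] := (((χ (τ γ₂) : (PadicAlgCl p)ˣ) : PadicAlgCl p) : ℂ_[p]) with hv₂_def
  have hu1 : avatarValueAt (e.comp (χ ^ 1)) γ₁ = u := by rw [hval, pow_one]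
  have hv₁1 : avatarValueAt (e.comp (χ ^ 1)) (τ γ₁) = v₁ := by rw [hval, pow_one]
  have hv₂1 : avatarValueAt (e.comp (χ ^ 1)) (τ γ₂) = v₂ := by rw [hval, pow_one]
  -- norms
  have hnorm : ∀ g, ‖avatarValueAt (e.comp (χ ^ 1)) g‖ = 1 := fun g ↦ norm_avatarValueAt_eq_one _ g
  have hu_norm : ‖u‖ = 1 := by rw [← hu1]; exact hnorm γ₁
  have hv₁_norm : ‖v₁‖ = 1 := by rw [← hv₁1]; exact hnorm _
  have hv₂_norm : ‖v₂‖ = 1 := by rw [← hv₂1]; exact hnorm _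
  have hu_ne : u ≠ 0 := fun h ↦ by simp [h] at hu_norm
  have hv₁_ne : v₁ ≠ 0 := fun h ↦ by simp [h] at hv₁_norm
  have hv₂_ne : v₂ ≠ 0 := fun h ↦ by simp [h] at hv₂_norm
  have hu_small : ‖u - 1‖ < ‖(p : ℂ_[p])‖ := by rw [← hu1]; exact hsmall 1 γ₁
  have hv₁_small : ‖v₁ - 1‖ < ‖(p : ℂ_[p])‖ := by rw [← hv₁1]; exact hsmall 1 _
  have hv₂_small : ‖v₂ - 1‖ < ‖(p : ℂ_[p])‖ := by rw [← hv₂1]; exact hsmall 1 _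
  -- non-torsion: `χ(γ₁)` (`κ₁ γ₁ = 1`) and `χ(τ γ₂)` (`κ₁ (τ γ₂) ≠ 0`, the frame geometry)
  have hκγ₁ : κ₁ γ₁ ≠ 1 := by
    rw [hpair.left]; exact fun h ↦ one_ne_zero (Multiplicative.ofAdd.injective (h.trans ofAdd_zero.symm))
  have hκτγ₂ : κ₁ (τ γ₂) ≠ 1 := by
    have h := FrameInvolution.frameMatrixOf_zero_one_ne_zero (p := p) hK hpair
      (Literature.NumberTheory.NumberFields.under_eq_under_of_natCast_mem K h3 h3') hne hur₁ hc hτ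
    rw [IwasawaAlgebra₂.frameMatrixOf_apply_zero_one] at h
    exact fun h1 ↦ h (by rw [h1]; rfl)
  have hu_pow : ∀ n : ℕ, 0 < n → u ^ n ≠ 1 := by
    intro n hn hun
    apply hntors n hn γ₁ hκγ₁
    have : ((((χ γ₁ ^ n : (PadicAlgCl p)ˣ)) : PadicAlgCl p) : ℂ_[p]) = ((1 : PadicAlgCl p) : ℂ_[p]) := by
      rw [Units.val_pow_eq_pow_val, PadicComplex.coe_eq, map_pow, ← PadicComplex.coe_eq, ← hu_def, hun, PadicComplex.coe_eq, map_one]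
    rw [PadicComplex.coe_eq, PadicComplex.coe_eq] at this
    exact Units.ext ((algebraMap (PadicAlgCl p) ℂ_[p]).injective this)
  have hv₂_pow : ∀ n : ℕ, 0 < n → v₂ ^ n ≠ 1 := by
    intro n hn hvn
    apply hntors n hn (τ γ₂) hκτγ₂
    have : ((((χ (τ γ₂) ^ n : (PadicAlgCl p)ˣ)) : PadicAlgCl p) : ℂ_[p]) = ((1 : PadicAlgCl p) : ℂ_[p]) := by
      rw [Units.val_pow_eq_pow_val, PadicComplex.coe_eq, map_pow, ← PadicComplex.coe_eq, ← hv₂_def, hvn, PadicComplex.coe_eq,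
        map_one]
    rw [PadicComplex.coe_eq, PadicComplex.coe_eq] at this
    exact Units.ext ((algebraMap (PadicAlgCl p) ℂ_[p]).injective this)
  -- `ϖ = p`
  have hϖ0 : (p : ℂ_[p]) ≠ 0 := by exact_mod_cast hp.ne_zero
  have hϖ1 : ‖(p : ℂ_[p])‖ < 1 := by
    rw [← PadicComplex.coe_natCast p p, PadicComplex.norm_extends p]; exact PadicAlgCl.norm_natCast_self_lt_one
  have hpow_small : ∀ {w : ℂ_[p]}, ‖w - 1‖ < ‖(p : ℂ_[p])‖ → ∀ n : ℕ, ‖w ^ n - 1‖ < ‖(p : ℂ_[p])‖ := fun hw n ↦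
    (RamifiedSevenEllipticUnits.LemmaXi.norm_pow_sub_one_le (hw.le.trans hϖ1.le) n).trans_lt hw
  -- types and ramification of the powers of `Ψ`
  have htypeΨ : ∀ m : ℕ, (Ψ ^ m).HasInfinityType (fun _ ↦ ((k * m : ℕ) : ℤ)) (fun _ ↦ (0 : ℤ)) := by
    intro m
    have h1 := hΨt.zpow' (m : ℤ)
    rw [zpow_natCast] at h1
    convert h1 using 2 <;> simp only [Pi.smul_apply, smul_eq_mul] <;> push_cast <;> ring
  have hunrΨ : ∀ (m : ℕ) (w : HeightOneSpectrum (𝓞 K)), (Ψ ^ m).IsUnramifiedAt w :=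
    fun m w ↦ isUnramifiedAt_pow' (hΨu w) _
  -- the inner values `y_j = v₂^{j+1} − 1`
  have hinjD : Function.Injective fun j : ℕ ↦ v₂ ^ (j + 1) - 1 := by
    simpa only [one_mul] using injective_mul_pow_sub_one (one_ne_zero) hv₂_ne hv₂_pow
  refine ⟨(p : ℂ_[p]), hϖ0, hϖ1, Set.range fun j : ℕ ↦ v₂ ^ (j + 1) - 1, Set.infinite_range_of_injective hinjD, ?_, ?_⟩
  · rintro y ⟨j, rfl⟩
    exact (hpow_small hv₂_small (j + 1)).le
  rintro y ⟨j, rfl⟩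
  -- the reflected partner of `Ψ^{M(j+1)}`: `ψ₂ = (Ψ^{M(j+1)} ∘ c̄)⁻¹` with avatar `e ∘ (χ^{j+1})†`
  set g := absGaloisQuot ℚ K c with hgdef
  set ρ₂ : absoluteGaloisGroup K →ₜ* (PadicAlgCl p)ˣ := (detChar (FramedGaloisRep.outerConj c (e.comp (χ ^ (j + 1)))))⁻¹ with hρ₂
  have hr₂ : IsPAdicAvatarOf ι' (HeckeCharacter.galConj g (Ψ ^ (M * (j + 1))))⁻¹ (e.comp ρ₂) :=
    ReflectedAvatar.isPAdicAvatarOf_reflected ι' c (hall (j + 1)).1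
  have hr₂κ : FactorsThroughPair κ₁ κ₂ (e.comp ρ₂) := ReflectedAvatar.factorsThroughPair_reflected hK hpair hτ (hall (j + 1)).2
  have hr₂val : ∀ g' : absoluteGaloisGroup K, avatarValueAt (e.comp ρ₂) g' = avatarValueAt (e.comp (χ ^ (j + 1))) (τ g') :=
    fun g' ↦ ReflectedAvatar.avatarValueAt_reflected_eq_conjInv hτ _ g'
  have hinfj : (Ψ ^ (M * (j + 1))).HasInfinityType (fun _ ↦ ((k * (M * (j + 1)) : ℕ) : ℤ)) (fun _ ↦ -((0 : ℕ) : ℤ)) := by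
    simpa only [Nat.cast_zero, neg_zero] using htypeΨ (M * (j + 1))
  have hinf₂ : (HeckeCharacter.galConj g (Ψ ^ (M * (j + 1))))⁻¹.HasInfinityType (fun _ ↦ ((0 : ℕ) : ℤ))
      (fun _ ↦ -((k * (M * (j + 1)) : ℕ) : ℤ)) := ReflectedAvatar.hasInfinityType_reflectedChar hK hc hinfj
  have hunr₂ : ∀ w : HeightOneSpectrum (𝓞 K), (HeckeCharacter.galConj g (Ψ ^ (M * (j + 1))))⁻¹.IsUnramifiedAt w :=
    ReflectedAvatar.isUnramifiedAt_reflectedChar g (hunrΨ _)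
  -- the fibre over `y_j` contains `x_i = v₁^{j+1} · u^{i+1} − 1` for every `i`
  have hinjF : Function.Injective fun i : ℕ ↦ v₁ ^ (j + 1) * u ^ (i + 1) - 1 :=
    injective_mul_pow_sub_one (pow_ne_zero _ hv₁_ne) hu_ne hu_pow
  refine Set.infinite_of_injective_forall_mem hinjF fun i ↦ ?_
  -- the datum `ψ = Ψ^{M(i+1)} · ψ₂`, `r = e ∘ (χ^{i+1} · ρ₂)`
  set a : ℕ := k * (M * (i + 1)) with ha_def
  set b : ℕ := k * (M * (j + 1)) with hb_def
  have ha : 1 ≤ a := Nat.mul_pos hk (Nat.mul_pos hM (Nat.succ_pos i))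
  have hb : 1 ≤ b := Nat.mul_pos hk (Nat.mul_pos hM (Nat.succ_pos j))
  set ψ : HeckeCharacter K := Ψ ^ (M * (i + 1)) * (HeckeCharacter.galConj g (Ψ ^ (M * (j + 1))))⁻¹ with hψ_def
  have hinf : ψ.HasInfinityType (fun _ ↦ (a : ℤ)) (fun _ ↦ -(b : ℤ)) := by
    have h := (htypeΨ (M * (i + 1))).mul' hinf₂
    convert h using 2 <;> simp only [Pi.add_apply, ha_def, hb_def] <;> push_cast <;> ring
  have hunr : ∀ w : HeightOneSpectrum (𝓞 K), ψ.IsUnramifiedAt w := fun w ↦ (hunrΨ _ w).mul' (hunr₂ w)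
  have hr : IsPAdicAvatarOf ι' ψ (e.comp (χ ^ (i + 1) * ρ₂)) :=
    isPAdicAvatarOf_mul ι' (hall (i + 1)).1 hr₂ (fun w _ _ ↦ ⟨hunrΨ _ w, hunr₂ w⟩)
  have hrκ : FactorsThroughPair κ₁ κ₂ (e.comp (χ ^ (i + 1) * ρ₂)) :=
    factorsThroughPair_unitsChar_mul (hall (i + 1)).2 hr₂κ
  obtain ⟨L, hLd, hLe⟩ := jacquet1972_functionalEquation_rankinSelbergHecke_cone.exists_entire hJ hK Dt.isNewformOf.1 hH ψ ha hb
    hunr hinf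
  -- its values at `γ₁`, `γ₂`
  have hx : avatarValueAt (e.comp (χ ^ (i + 1) * ρ₂)) γ₁ = v₁ ^ (j + 1) * u ^ (i + 1) := by
    rw [he, avatarValueAt_unitsChar_mul, ← he, hr₂val, hval, hval, ← hu_def, ← hv₁_def, mul_comm]
  have hy : avatarValueAt (e.comp (χ ^ (i + 1) * ρ₂)) γ₂ = v₂ ^ (j + 1) := by
    rw [he, avatarValueAt_unitsChar_mul, ← he, hr₂val, hval, hval, hχγ₂, ← hv₂_def, Units.val_one, PadicComplex.coe_eq, map_one,
      one_pow, one_mul]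
  refine ⟨?_, ψ, a, b, e.comp (χ ^ (i + 1) * ρ₂), L, ha, hb, hinf, hunr, hr, hrκ, hLd, hLe, by rw [hx], by rw [hy]⟩
  -- the bound `‖x‖ ≤ ‖p‖`
  have hu_pow_norm : ‖u ^ (i + 1)‖ ≤ 1 := by rw [norm_pow, hu_norm, one_pow]
  have h1 : ‖u ^ (i + 1) * v₁ ^ (j + 1) - 1‖ < ‖(p : ℂ_[p])‖ :=
    norm_mul_sub_one_lt hu_pow_norm (hpow_small hu_small _) (hpow_small hv₁_small _)
  rw [mul_comm] at h1
  exact h1.le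

end Summit.BirchSwinnertonDyer.BirchSwinnertonDyer.Theorems.UniversalToricDescentThinComb.FibredSupply

end
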